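import Summits.Ventures.Crystal3D.Theorems.StickyWulffConstantGenericWallFloorSigma9CellsWith
import Summits.Ventures.Crystal3D.Theorems.StickyWulffConstantGenericWallFloorSigma9TiltCellsWith
import Summits.Ventures.Crystal3D.Theorems.StickyWulffConstantGenericWallFloorSigma9WideCellsWith
import Summits.Ventures.Crystal3D.Theorems.StickyWulffConstantGenericWallFloorSeparatedWideWith
import Summits.Ventures.Crystal3D.Theorems.StickyWulffConstantGenericWallFloorStackLedgerOneSidedDirsWith
import Summits.Ventures.Crystal3D.Theorems.StickyWulffConstantGenericWallFloorStackLedgerOneSidedDownDirsWith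
import HarnessLib

/-!
# Restatement programme, GENERIC cone: THE UNIFORM LANE-G CLOSER at charge `c₀` in explicit-constant currency
# (`twoSlabLedgerWith_all_of_coverage`; crux `GenericWallFloor`, stmt-Ventures-19480, line `WallLedgerG`; cf-p1 (lxvii)(2), P5 (i))

HONEST FRAMING. Venture `Summits/Ventures/Crystal3D` (cell `crystal3d-full`); helper `--supports` the crux `GenericWallFloor` and lane T's
uniform port (T-V5 P5: `betaIIIAt_of_coverage` / `residualAt_of_coverage` are lane T's two-liners on the theorems below).  Rung credit
only (census-free, standard axioms); F-C1 not moved.  Named inputs BY NAME exactly as in `genericWallFloorAtCharge_all_of_coverage`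
(…ResidualCoverageDefs): `ExactOnly`(C12-55) / `P5Exhaustion` [E1], `StarPairFar`, and the named computational fact
`ResidualOneSidedCoverage c₀` (19480-p1's exact certificate, finite part certified 2026-08-29).

This is `genericWallFloorAtCharge_all_of_coverage` with the constant IN FRONT: the same excluded-middle dispatch along the residual
chain, every branch now a With-theorem with ONE constant for all pairs —
`twoSlabLedgerWith_of_not_rayAlignedAt` (¬RA), `twoSlabLedgerWith_of_sigma9{OneSided,OneSidedDown,Tilt,TiltDown,Wide,WideDown}At`
(the six priced `Σ9` cells), `twoSlabLedgerWith_of_separatedWideAt`, and for the covered residual the three certificate classes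
`twoSlabLedgerWith_of_oneSidedFamilyUpAt` / `…DownAt` (this file, on the W1-conditional one-sided With-leaves p685919/p685923) and
`twoSlabLedgerWith_of_separatedTiltAtCharge` — combined with `twoSlabLedgerWith_weaken` (max of the constants) and
`twoSlabLedgerWith_anti` (`c₀ ≤ 1`).

* `twoSlabLedgerWith_of_oneSidedFamilyUpAt` / `twoSlabLedgerWith_of_oneSidedFamilyDownAt` — one `C(c₀)` per class;
* `twoSlabLedgerWith_of_coveredAtCharge` — `CoveredAtCharge c₀ A₁ A₂ → TwoSlabLedgerWith C 10 c₀ A₁ t₁ A₂ t₂`, one `C(c₀)`;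
* **`twoSlabLedgerWith_all_of_coverage_star`** / **`twoSlabLedgerWith_all_of_coverage`** — for `0 < c₀ ≤ 1`:
  `ResidualOneSidedCoverage c₀ → ∃ C, ∀ A₁ t₁ A₂ t₂, ¬(Barlow-co-axial) → TwoSlabLedgerWith C 10 c₀ A₁ t₁ A₂ t₂`
  (modulo `ExactOnly`/`P5Exhaustion` and `StarPairFar`); `genericWallFloorAtCharge_of_twoSlabLedgerWith` recovers the per-pair form; the deficiency-form
  currency `GenericWallFloorWithCharge` is the sequel `…ResidualCoverageWithCharge`.
WHAT THIS IS NOT: a proof of `ResidualOneSidedCoverage c₀`; not `c₀ = 1` for the crux; F-C1 not moved.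
-/

noncomputable section

namespace Summit.Ventures.Crystal3D.Theorems

open Summit.Ventures.Crystal3D Finset
open Literature.MathematicalPhysics.StatisticalMechanics (fccStacking barlowStacking IsHaggSeq)
open scoped InnerProductSpace

/-! ### The two one-sided certificate classes -/

open scoped Classical in
/-- **`OneSidedFamilyUpAt c₀` at explicit constants**: one `C` (depending on `c₀` through the walker room `9/(√2 c₀)`) with
`OneSidedFamilyUpAt c₀ A₁ A₂ → TwoSlabLedgerWith C 10 c₀ A₁ t₁ A₂ t₂` for all translations (modulo `ExactOnly`(C12-55), `StarPairFar`). -/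
theorem twoSlabLedgerWith_of_oneSidedFamilyUpAt {c₀ : ℝ} (hc₀ : 0 < c₀) : ∃ C : ℝ, ∀
    {s₀ : EuclideanSpace ℝ (Fin 3)} (hs₀ : s₀ ∈ fccSlots)
    (hcert : ExactOnly 0 (fccSlots.filter fun w => 0 < ⟪w, s₀⟫_ℝ)) (hSP : StarPairFar)
    {A₁ A₂ : EuclideanSpace ℝ (Fin 3) ≃ₗᵢ[ℝ] EuclideanSpace ℝ (Fin 3)} (h : OneSidedFamilyUpAt c₀ A₁ A₂)
    (t₁ t₂ : EuclideanSpace ℝ (Fin 3)), TwoSlabLedgerWith C 10 c₀ A₁ t₁ A₂ t₂ := by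
  obtain ⟨K, hK⟩ := twoSlabAdhesionWith_stackLedger_oneSided_dirs
  refine ⟨(240 * Real.sqrt 2 * Real.pi + 4440 * (4 * 10 + 2)) / 2 + (128 + 16 * (9 / (Real.sqrt 2 * c₀)) + 24192) + K, ?_⟩
  intro s₀ hs₀ hcert hSP A₁ A₂ h t₁ t₂
  obtain ⟨z, u₁, hz, hu₁, hsteep, hrise, hmiss, hdirs⟩ := h
  have hδ : 0 < Real.sqrt 2 * c₀ := by positivity
  have he₃i : ⟪A₁ u₁, EuclideanSpace.single (2 : Fin 3) (1 : ℝ)⟫_ℝ = (A₁ u₁) 2 := by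
    rw [EuclideanSpace.inner_single_right]; simp
  have habs : |⟪A₁ u₁, EuclideanSpace.single (2 : Fin 3) (1 : ℝ)⟫_ℝ| = (A₁ u₁) 2 := by
    rw [he₃i]; exact abs_of_nonneg (by linarith)
  have hled := hK hs₀ hcert (doubleStarCoaxialAt_of_starPairFar hSP) (capPairCoaxial_of_starPairFar hSP) A₁ t₁ A₂ t₂ hz hu₁
    hsteep hδ hrise
    {F | ∃ stk : List WalkEntry, StackSound z stk ∧ StackWF z stk ∧ stk.getLast? = some ⟨A₁, u₁, 0⟩ ∧ ∃ e ∈ stk, e.frame = F}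
    (fun stk hS hW hlast e he => ⟨stk, hS, hW, hlast, e, he, rfl⟩)
    (fun _ ⟨stk, hS, hW, hl, e, he, hF⟩ => by rw [← hF]; exact hmiss stk hS hW hl e he) hdirs
  rw [habs] at hled
  exact twoSlabLedgerWith_anti (charge_le_of_sqrt_two_mul_le hrise) hled

open scoped Classical in
/-- **`OneSidedFamilyDownAt c₀` at explicit constants**: one `C(c₀)` with
`OneSidedFamilyDownAt c₀ A₁ A₂ → TwoSlabLedgerWith C 10 c₀ A₁ t₁ A₂ t₂` for all translations (modulo `ExactOnly`(C12-55), `StarPairFar`). -/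
theorem twoSlabLedgerWith_of_oneSidedFamilyDownAt {c₀ : ℝ} (hc₀ : 0 < c₀) : ∃ C : ℝ, ∀
    {s₀ : EuclideanSpace ℝ (Fin 3)} (hs₀ : s₀ ∈ fccSlots)
    (hcert : ExactOnly 0 (fccSlots.filter fun w => 0 < ⟪w, s₀⟫_ℝ)) (hSP : StarPairFar)
    {A₁ A₂ : EuclideanSpace ℝ (Fin 3) ≃ₗᵢ[ℝ] EuclideanSpace ℝ (Fin 3)} (h : OneSidedFamilyDownAt c₀ A₁ A₂)
    (t₁ t₂ : EuclideanSpace ℝ (Fin 3)), TwoSlabLedgerWith C 10 c₀ A₁ t₁ A₂ t₂ := by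
  obtain ⟨K, hK⟩ := twoSlabAdhesionWith_stackLedger_oneSidedDown_dirs
  refine ⟨(240 * Real.sqrt 2 * Real.pi + 4440 * (4 * 10 + 2)) / 2 + (128 + 16 * (9 / (Real.sqrt 2 * c₀)) + 24192) + K, ?_⟩
  intro s₀ hs₀ hcert hSP A₁ A₂ h t₁ t₂
  obtain ⟨z, u₂, hz, hu₂, hsteep, hdown, hmiss, hdirs⟩ := h
  have hδ : 0 < Real.sqrt 2 * c₀ := by positivity
  have he₃i : ⟪A₂ u₂, EuclideanSpace.single (2 : Fin 3) (1 : ℝ)⟫_ℝ = (A₂ u₂) 2 := by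
    rw [EuclideanSpace.inner_single_right]; simp
  have habs : |⟪A₂ u₂, EuclideanSpace.single (2 : Fin 3) (1 : ℝ)⟫_ℝ| = -(A₂ u₂) 2 := by
    rw [he₃i]; exact abs_of_nonpos (by linarith)
  have hled := hK hs₀ hcert (doubleStarCoaxialAt_of_starPairFar hSP) (capPairCoaxial_of_starPairFar hSP) A₁ t₁ A₂ t₂ hz hu₂
    hsteep hδ hdown
    {F | ∃ stk : List WalkEntry, StackSound z stk ∧ StackWF z stk ∧ stk.getLast? = some ⟨A₂, u₂, 0⟩ ∧ ∃ e ∈ stk, e.frame = F}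
    (fun stk hS hW hlast e he => ⟨stk, hS, hW, hlast, e, he, rfl⟩)
    (fun _ ⟨stk, hS, hW, hl, e, he, hF⟩ => by rw [← hF]; exact hmiss stk hS hW hl e he) hdirs
  rw [habs] at hled
  exact twoSlabLedgerWith_anti (charge_le_of_sqrt_two_mul_le hdown) hled

/-! ### Covered pairs -/

/-- **Covered pairs at explicit constants**: for `0 < c₀` one `C(c₀)` with `CoveredAtCharge c₀ A₁ A₂ → TwoSlabLedgerWith C 10 c₀ A₁ t₁ A₂ t₂`
for all translations (modulo `ExactOnly`(C12-55), `StarPairFar`) — the max of the three class constants. -/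
theorem twoSlabLedgerWith_of_coveredAtCharge {c₀ : ℝ} (hc₀ : 0 < c₀) : ∃ C : ℝ, ∀
    {s₀ : EuclideanSpace ℝ (Fin 3)} (hs₀ : s₀ ∈ fccSlots)
    (hcert : ExactOnly 0 (fccSlots.filter fun w => 0 < ⟪w, s₀⟫_ℝ)) (hSP : StarPairFar)
    {A₁ A₂ : EuclideanSpace ℝ (Fin 3) ≃ₗᵢ[ℝ] EuclideanSpace ℝ (Fin 3)} (h : CoveredAtCharge c₀ A₁ A₂)
    (t₁ t₂ : EuclideanSpace ℝ (Fin 3)), TwoSlabLedgerWith C 10 c₀ A₁ t₁ A₂ t₂ := by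
  obtain ⟨C₁, h₁⟩ := twoSlabLedgerWith_of_oneSidedFamilyUpAt hc₀
  obtain ⟨C₂, h₂⟩ := twoSlabLedgerWith_of_oneSidedFamilyDownAt hc₀
  obtain ⟨C₃, h₃⟩ := twoSlabLedgerWith_of_separatedTiltAtCharge
  refine ⟨max C₁ (max C₂ C₃), ?_⟩
  intro s₀ hs₀ hcert hSP A₁ A₂ h t₁ t₂
  have h10 : (0 : ℝ) ≤ 10 := by norm_num
  rcases h with h | h | h
  · exact twoSlabLedgerWith_weaken h10 (le_max_left _ _) (h₁ hs₀ hcert hSP h t₁ t₂)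
  · exact twoSlabLedgerWith_weaken h10 ((le_max_left _ _).trans (le_max_right _ _)) (h₂ hs₀ hcert hSP h t₁ t₂)
  · exact twoSlabLedgerWith_weaken h10 ((le_max_right _ _).trans (le_max_right _ _)) (h₃ hs₀ hcert hSP h t₁ t₂)

/-! ### The uniform closer -/

/-- **THE UNIFORM LANE-G CLOSER AT CHARGE `c₀ ∈ (0, 1]`, `ExactOnly` form.**  Modulo `ExactOnly`(C12-55), `StarPairFar` and the named
fact `ResidualOneSidedCoverage c₀`: ONE constant `C` such that EVERY non-co-axial pair, with every pair of translations, satisfies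
`TwoSlabLedgerWith C 10 c₀ A₁ t₁ A₂ t₂` — the dispatch of `genericWallFloorAtCharge_all_of_coverage_star` verbatim, branch by branch in
With-currency. -/
theorem twoSlabLedgerWith_all_of_coverage_star
    {s₀ : EuclideanSpace ℝ (Fin 3)} (hs₀ : s₀ ∈ fccSlots)
    (hcert : ExactOnly 0 (fccSlots.filter fun w => 0 < ⟪w, s₀⟫_ℝ)) (hSP : StarPairFar)
    {c₀ : ℝ} (hc₀ : 0 < c₀) (hc₁ : c₀ ≤ 1) (hcov : ResidualOneSidedCoverage c₀) :
    ∃ C : ℝ, ∀ (A₁ : EuclideanSpace ℝ (Fin 3) ≃ₗᵢ[ℝ] EuclideanSpace ℝ (Fin 3)) (t₁ : EuclideanSpace ℝ (Fin 3))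
      (A₂ : EuclideanSpace ℝ (Fin 3) ≃ₗᵢ[ℝ] EuclideanSpace ℝ (Fin 3)) (t₂ : EuclideanSpace ℝ (Fin 3)),
      (¬ ∃ (L : EuclideanSpace ℝ (Fin 3) ≃ₗᵢ[ℝ] EuclideanSpace ℝ (Fin 3)) (s₁ s₂ : EuclideanSpace ℝ (Fin 3))
        (σ σ' : ℤ → ℤ), IsHaggSeq σ ∧ IsHaggSeq σ' ∧
        (fun p => A₁ p + t₁) '' fccStacking 1 (Real.sqrt (2 / 3)) ⊆
          (fun p => L p + s₁) '' barlowStacking 1 (Real.sqrt (2 / 3)) σ ∧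
        (fun p => A₂ p + t₂) '' fccStacking 1 (Real.sqrt (2 / 3)) ⊆
          (fun p => L p + s₂) '' barlowStacking 1 (Real.sqrt (2 / 3)) σ') →
      TwoSlabLedgerWith C 10 c₀ A₁ t₁ A₂ t₂ := by
  obtain ⟨D₀, hD₀⟩ := twoSlabLedgerWith_of_not_rayAlignedAt
  obtain ⟨D₁, hD₁⟩ := twoSlabLedgerWith_of_sigma9OneSidedAt
  obtain ⟨D₂, hD₂⟩ := twoSlabLedgerWith_of_sigma9OneSidedDownAt
  obtain ⟨D₃, hD₃⟩ := twoSlabLedgerWith_of_sigma9TiltAt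
  obtain ⟨D₄, hD₄⟩ := twoSlabLedgerWith_of_sigma9TiltDownAt
  obtain ⟨D₅, hD₅⟩ := twoSlabLedgerWith_of_sigma9WideAt
  obtain ⟨D₆, hD₆⟩ := twoSlabLedgerWith_of_sigma9WideDownAt
  obtain ⟨D₇, hD₇⟩ := twoSlabLedgerWith_of_separatedWideAt
  obtain ⟨D₈, hD₈⟩ := twoSlabLedgerWith_of_coveredAtCharge hc₀
  -- one constant above all nine
  set C : ℝ := |D₀| + |D₁| + |D₂| + |D₃| + |D₄| + |D₅| + |D₆| + |D₇| + |D₈| with hC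
  have habs : ∀ x : ℝ, x ≤ |x| := fun x => le_abs_self x
  have hnn : ∀ x : ℝ, 0 ≤ |x| := fun x => abs_nonneg x
  have e0 : D₀ ≤ C := by
    have := habs D₀; have := hnn D₁; have := hnn D₂; have := hnn D₃; have := hnn D₄; have := hnn D₅; have := hnn D₆
    have := hnn D₇; have := hnn D₈; rw [hC]; linarith
  have e1 : D₁ ≤ C := by
    have := hnn D₀; have := habs D₁; have := hnn D₂; have := hnn D₃; have := hnn D₄; have := hnn D₅; have := hnn D₆
    have := hnn D₇; have := hnn D₈; rw [hC]; linarith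
  have e2 : D₂ ≤ C := by
    have := hnn D₀; have := hnn D₁; have := habs D₂; have := hnn D₃; have := hnn D₄; have := hnn D₅; have := hnn D₆
    have := hnn D₇; have := hnn D₈; rw [hC]; linarith
  have e3 : D₃ ≤ C := by
    have := hnn D₀; have := hnn D₁; have := hnn D₂; have := habs D₃; have := hnn D₄; have := hnn D₅; have := hnn D₆
    have := hnn D₇; have := hnn D₈; rw [hC]; linarith
  have e4 : D₄ ≤ C := by
    have := hnn D₀; have := hnn D₁; have := hnn D₂; have := hnn D₃; have := habs D₄; have := hnn D₅; have := hnn D₆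
    have := hnn D₇; have := hnn D₈; rw [hC]; linarith
  have e5 : D₅ ≤ C := by
    have := hnn D₀; have := hnn D₁; have := hnn D₂; have := hnn D₃; have := hnn D₄; have := habs D₅; have := hnn D₆
    have := hnn D₇; have := hnn D₈; rw [hC]; linarith
  have e6 : D₆ ≤ C := by
    have := hnn D₀; have := hnn D₁; have := hnn D₂; have := hnn D₃; have := hnn D₄; have := hnn D₅; have := habs D₆
    have := hnn D₇; have := hnn D₈; rw [hC]; linarith
  have e7 : D₇ ≤ C := by
    have := hnn D₀; have := hnn D₁; have := hnn D₂; have := hnn D₃; have := hnn D₄; have := hnn D₅; have := hnn D₆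
    have := habs D₇; have := hnn D₈; rw [hC]; linarith
  have e8 : D₈ ≤ C := by
    have := hnn D₀; have := hnn D₁; have := hnn D₂; have := hnn D₃; have := hnn D₄; have := hnn D₅; have := hnn D₆
    have := hnn D₇; have := habs D₈; rw [hC]; linarith
  refine ⟨C, fun A₁ t₁ A₂ t₂ hnc => ?_⟩
  have h10 : (0 : ℝ) ≤ 10 := by norm_num
  -- charge `1` branches are lowered to `c₀`
  have hone : ∀ {D : ℝ}, D ≤ C → TwoSlabLedgerWith D 10 1 A₁ t₁ A₂ t₂ → TwoSlabLedgerWith C 10 c₀ A₁ t₁ A₂ t₂ :=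
    fun hD h => twoSlabLedgerWith_weaken h10 hD (twoSlabLedgerWith_anti hc₁ h)
  by_cases hra : RayAlignedAt A₁ A₂
  swap
  · exact hone e0 (hD₀ hs₀ hcert hSP hra t₁ t₂)
  by_cases h₁ : Sigma9OneSidedAt A₁ A₂
  · exact hone e1 (hD₁ hs₀ hcert hSP h₁ t₁ t₂)
  by_cases h₂ : Sigma9OneSidedDownAt A₁ A₂
  · exact hone e2 (hD₂ hs₀ hcert hSP h₂ t₁ t₂)
  by_cases h₃ : Sigma9TiltAt A₁ A₂
  · exact hone e3 (hD₃ hs₀ hcert hSP h₃ t₁ t₂)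
  by_cases h₄ : Sigma9TiltDownAt A₁ A₂
  · exact hone e4 (hD₄ hs₀ hcert hSP h₄ t₁ t₂)
  by_cases h₅ : Sigma9WideAt A₁ A₂
  · exact hone e5 (hD₅ hs₀ hcert hSP h₅ t₁ t₂)
  by_cases h₆ : Sigma9WideDownAt A₁ A₂
  · exact hone e6 (hD₆ hs₀ hcert hSP h₆ t₁ t₂)
  by_cases h₇ : SeparatedWideAt A₁ A₂
  · exact hone e7 (hD₇ hs₀ hcert hSP h₇ t₁ t₂)
  exact twoSlabLedgerWith_weaken h10 e8
    (hD₈ hs₀ hcert hSP (hcov A₁ A₂ (fun h => hnc (coaxial_translate_of_frames t₁ t₂ h)) hra h₁ h₂ h₃ h₄ h₅ h₆ h₇) t₁ t₂)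

/-- **THE UNIFORM LANE-G CLOSER AT CHARGE `c₀ ∈ (0, 1]`**: `P5Exhaustion → StarPairFar → ResidualOneSidedCoverage c₀ →` ONE constant `C`
with `TwoSlabLedgerWith C 10 c₀ A₁ t₁ A₂ t₂` for EVERY non-co-axial pair of moved fcc lattices.  (Lane T: `bilayerWallAt_of_adhesionAt`
turns this into `BilayerWallAt (C + 60√2π) 10 …` for every `BothFcc` plate pair whose bilayer frames are not co-axial.) -/
theorem twoSlabLedgerWith_all_of_coverage (hE1 : P5Exhaustion) (hSP : StarPairFar)
    {c₀ : ℝ} (hc₀ : 0 < c₀) (hc₁ : c₀ ≤ 1) (hcov : ResidualOneSidedCoverage c₀) :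
    ∃ C : ℝ, ∀ (A₁ : EuclideanSpace ℝ (Fin 3) ≃ₗᵢ[ℝ] EuclideanSpace ℝ (Fin 3)) (t₁ : EuclideanSpace ℝ (Fin 3))
      (A₂ : EuclideanSpace ℝ (Fin 3) ≃ₗᵢ[ℝ] EuclideanSpace ℝ (Fin 3)) (t₂ : EuclideanSpace ℝ (Fin 3)),
      (¬ ∃ (L : EuclideanSpace ℝ (Fin 3) ≃ₗᵢ[ℝ] EuclideanSpace ℝ (Fin 3)) (s₁ s₂ : EuclideanSpace ℝ (Fin 3))
        (σ σ' : ℤ → ℤ), IsHaggSeq σ ∧ IsHaggSeq σ' ∧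
        (fun p => A₁ p + t₁) '' fccStacking 1 (Real.sqrt (2 / 3)) ⊆
          (fun p => L p + s₁) '' barlowStacking 1 (Real.sqrt (2 / 3)) σ ∧
        (fun p => A₂ p + t₂) '' fccStacking 1 (Real.sqrt (2 / 3)) ⊆
          (fun p => L p + s₂) '' barlowStacking 1 (Real.sqrt (2 / 3)) σ') →
      TwoSlabLedgerWith C 10 c₀ A₁ t₁ A₂ t₂ := by
  obtain ⟨s₀, hs₀, hcert⟩ := exactOnly_star_of_p5Exhaustion hE1
  exact twoSlabLedgerWith_all_of_coverage_star hs₀ hcert hSP hc₀ hc₁ hcov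

/-- **Back to the per-pair currency** (sanity): the uniform closer implies `genericWallFloorAtCharge_all_of_coverage`'s conclusion
for each pair (`twoSlabLedgerAt_of_with` + `genericWallFloorAtCharge_of_ledger`). -/
theorem genericWallFloorAtCharge_of_twoSlabLedgerWith {C c₀ : ℝ}
    {A₁ : EuclideanSpace ℝ (Fin 3) ≃ₗᵢ[ℝ] EuclideanSpace ℝ (Fin 3)} {t₁ : EuclideanSpace ℝ (Fin 3)}
    {A₂ : EuclideanSpace ℝ (Fin 3) ≃ₗᵢ[ℝ] EuclideanSpace ℝ (Fin 3)} {t₂ : EuclideanSpace ℝ (Fin 3)}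
    (h : TwoSlabLedgerWith C 10 c₀ A₁ t₁ A₂ t₂) : GenericWallFloorAtCharge c₀ A₁ t₁ A₂ t₂ :=
  genericWallFloorAtCharge_of_ledger _ A₁ t₁ A₂ t₂ (twoSlabLedgerAt_of_with (by norm_num) h)

end Summit.Ventures.Crystal3D.Theorems

end
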